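import Literature.AnabelianGeometry.EtaleTheta.ThetaRigidity
import Literature.AnabelianGeometry.EtaleTheta.Discharge.Sec2EnvelopeLemmas

/-!
# The mod-`N` cyclotomic character is group-theoretic ([EtTh] Cor 2.18 (i)/(iv); proof-only companion)

Mochizuki, *The Étale Theta Function …* [EtTh], Publ. RIMS 45 (2009), §2, Cor 2.18, PRIMS text
pp.60–63 (locators `p.N` = PDF pages; bib key `MochizukiEtTh2009`).

PROOF-ONLY companion of `ThetaRigidity.lean` (seat abc-iut-L2-t2), unit W2-L2-06 / Cor 2.18
(abc-iut-L2-t10). `RigidData.chi_aug_invariant`: an automorphism `γ` of `Π^tp_X` preserving the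
subquotient `(l·Δ_Θ)` and the kernel `Ker(Π^tp_X ↠ (Π^tp_X)^Θ)` (two of the invariances of the
named fact `Cor218_i`) preserves the mod-`N` cyclotomic character: `χ(aug(γ x)) = χ(aug x)`.
Indeed `γ` induces, through `thetaMod : (l·Δ_Θ) ↠ μ_N`, an endomorphism of the cyclic group
`μ_N`, which is a power map and hence commutes with the `χ`-action, while `thetaMod` is
`Π^tp_X`-equivariant (`thetaMod_conj`). This discharges the hypothesis `hχ` of
`RigidData.cor218_iv_surjective_of` (`Sec2LiftingSurjProofs`) from `Cor218_i`.
-/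

namespace Literature.AnabelianGeometry.EtaleTheta

universe u

namespace RigidData

variable {N : ℕ+} {l : ℕ} (R : RigidData.{u} N l)

/-- **The cyclotomic character is determined by the theta subquotients**: if `γ ∈ Aut(Π^tp_X)`
preserves `Ker(Π^tp_X ↠ (Π^tp_X)^Θ)` and `(l·Δ_Θ)`, then `χ ∘ aug ∘ γ = χ ∘ aug`.
[cite: MochizukiEtTh2009, Cor 2.18(i) p.60] -/
theorem chi_aug_invariant (γ : R.PiX ≃ₜ* R.PiX)
    (hK : R.thetaKer.map γ.toMulEquiv.toMonoidHom = R.thetaKer)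
    (hL : R.lDeltaTheta.map γ.toMulEquiv.toMonoidHom = R.lDeltaTheta) (x : R.PiX) :
    R.chi (R.aug (γ x)) = R.chi (R.aug x) := by
  classical
  haveI := R.mu_cyclic
  have hLmem : ∀ g ∈ R.lDeltaTheta, γ g ∈ R.lDeltaTheta := fun g hg => by
    rw [← hL]; exact ⟨g, hg, rfl⟩
  have hLmem' : ∀ g ∈ R.lDeltaTheta, γ.symm g ∈ R.lDeltaTheta := fun g hg => by
    have h : g ∈ R.lDeltaTheta.map γ.toMulEquiv.toMonoidHom := by rw [hL]; exact hg
    obtain ⟨g₀, hg₀, hg₀eq⟩ := h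
    have : γ.symm g = g₀ := by rw [← hg₀eq]; exact γ.symm_apply_apply g₀
    rw [this]; exact hg₀
  have hKmem : ∀ g ∈ R.thetaKer, γ g ∈ R.thetaKer := fun g hg => by
    rw [← hK]; exact ⟨g, hg, rfl⟩
  -- `γ` restricted to `(l·Δ_Θ)`, followed by `thetaMod`
  let γL : R.lDeltaTheta →* R.lDeltaTheta :=
    (γ.toMulEquiv.toMonoidHom.restrict R.lDeltaTheta).codRestrict R.lDeltaTheta
      (fun g => hLmem g g.2)
  have hγL : ∀ g : R.lDeltaTheta, ((γL g : R.lDeltaTheta) : R.PiX) = γ (g : R.PiX) := fun g => rfl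
  let θ' : R.lDeltaTheta →* R.mu := R.thetaMod.comp γL
  -- `Ker(thetaMod) ⊆ Ker(thetaMod ∘ γ)`
  have hker : R.thetaMod.ker ≤ θ'.ker := by
    intro g hg
    rw [MonoidHom.mem_ker] at hg ⊢
    change R.thetaMod (γL g) = 1
    obtain ⟨k, hk, h, hgeq⟩ := (R.thetaMod_ker g).mp hg
    rw [R.thetaMod_ker]
    refine ⟨γ k, hKmem k hk, γL h, ?_⟩
    rw [hγL, hgeq, map_mul, map_pow, hγL]
  -- factor `thetaMod ∘ γ = φ ∘ thetaMod` with `φ` an endomorphism of `μ_N`, a power map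
  let φ : R.mu →* R.mu :=
    R.thetaMod.liftOfRightInverse (Function.surjInv R.thetaMod_surjective)
      (Function.rightInverse_surjInv R.thetaMod_surjective) ⟨θ', hker⟩
  have hφ : ∀ g : R.lDeltaTheta, φ (R.thetaMod g) = R.thetaMod (γL g) := fun g =>
    R.thetaMod.liftOfRightInverse_comp_apply _ _ ⟨θ', hker⟩ g
  obtain ⟨k, hk⟩ := MonoidHom.map_cyclic φ
  -- compare `thetaMod (γ (x g x⁻¹))` computed in two ways
  apply MulEquiv.ext
  intro m'
  obtain ⟨g, hg⟩ : ∃ g : R.lDeltaTheta, R.thetaMod (γL g) = m' := by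
    obtain ⟨g', hg'⟩ := R.thetaMod_surjective m'
    refine ⟨⟨γ.symm (g' : R.PiX), hLmem' _ g'.2⟩, ?_⟩
    rw [← hg']
    congr 1
    apply Subtype.ext
    rw [hγL]
    exact γ.apply_symm_apply _
  rw [← hg]
  have hconjmem : x * (g : R.PiX) * x⁻¹ ∈ R.lDeltaTheta := R.lDeltaTheta_normal.conj_mem _ g.2 x
  -- way 1: `thetaMod_conj` for `γ x`, `γ g`
  have h1 : R.thetaMod (γL ⟨x * g * x⁻¹, hconjmem⟩) =
      R.chi (R.aug (γ x)) (R.thetaMod (γL g)) := by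
    rw [← R.thetaMod_conj (γ x) (γL g)]
    congr 1
    apply Subtype.ext
    rw [hγL]
    change γ (x * g * x⁻¹) = γ x * ((γL g : R.lDeltaTheta) : R.PiX) * (γ x)⁻¹
    rw [hγL, map_mul, map_mul, map_inv]
  -- way 2: through `φ`, a power map, and `thetaMod_conj` for `x`, `g`
  have h2 : R.thetaMod (γL ⟨x * g * x⁻¹, hconjmem⟩) =
      R.chi (R.aug x) (R.thetaMod (γL g)) := by
    rw [← hφ, R.thetaMod_conj x g, hk, ← map_zpow, ← hk, hφ]
  rw [← h1, h2]

end RigidData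

end Literature.AnabelianGeometry.EtaleTheta
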